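import Literature.Barriers.CriticalPhenomena.SupercriticalSAWSpaceFillingUnconditional
import Literature.Probability.RandomPlanarGeometry.CritPercSLESelfTouchingProofs
import Literature.Probability.RandomPlanarGeometry.CaratheodoryHalfPlaneProofs
import HarnessLib

/-!
# Supercritical self-avoiding walks converge to no chordal SLE_κ with `κ < 8` — unconditionally

Barrier catalogue `Literature/Barriers/CriticalPhenomena/` (D-0021); complement to
`SupercriticalSAWSpaceFillingUnconditional` (third audit of the mechanism of
`SupercriticalSAWSpaceFilling`, 2026-08-15). The `blocks:` line of the audited mechanism
(`SupercriticalSAWSpaceFillingProofsNarrow`) covers "chordal SLE_κ for every `κ < 8`" by citing the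
dimension bound `dim γ[0,∞) ≤ 1 + κ/8` (Rohde–Schramm 2005, Thm 8.1) as the reason why such an
SLE is not almost surely onto the domain. For `0 < κ ≤ 4` this was made a hypothesis-free
theorem in `…Unconditional` (simple curves cover no open set). This file does the same for the
self-touching phase `4 < κ < 8`, from the tree's PROVED form of Rohde–Schramm's description of
that phase (`ae_isSelfTouching_sleTrace_holds`, `CritPercSLESelfTouchingProofs.lean`: almost
surely the trace is not injective and its range has EMPTY INTERIOR, from RS05 Lemma 6.3) and the
proved half-plane Carathéodory theorem (`JordanDomain.exists_hasBoundaryValue_holds`: the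
uniformizing map has a boundary value on `∂D` at every real point):

* `ae_not_carrier_subset_range_of_isSLECurve_of_lt_eight` — for `4 < κ < 8`, almost surely the
  chordal SLE_κ curve `Γ` of `(D; a, b)` is not onto `D`: if `D ⊆ trace Γ`, every `z ∈ ℍ` has
  `φ z = Γ(s) = Φ(γ t)`; `γ t` cannot be real (then `Φ(γ t) ∈ ∂D`, but `φ z ∈ D`) nor can `s` be
  the terminal parameter (`Γ(1) = b ∈ ∂D`), so `γ t ∈ ℍ` and `γ t = z` by injectivity of `φ`:
  `ℍ ⊆ γ[0,∞)`, contradicting the empty interior;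
* `not_ae_carrier_subset_range_of_isSLECurve_of_lt_eight'` — hence for every `0 < κ < 8`
  chordal SLE_κ is not almost surely onto `D`;
* `IsSpaceFillingLaws.not_convergesInLawToSLE_of_lt_eight`,
  `not_convergesInLawToSLE_supercritical_unitDisc_of_lt_eight` — weakly space-filling SAW laws,
  in particular the fugacity-`x` laws in `(𝔻; 1, -1)` for every `x > x_c` (Theorem 1 of
  Duminil-Copin–Kozma–Yadin, `DKY2014_thm1_holds`), converge in law to NO chordal SLE_κ with
  `0 < κ < 8` — hypothesis-free, in exact agreement with Conjecture 11 of the source (SLE₈ for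
  `x > 1/μ`), the only chordal SLEs left being the space-filling ones, `κ ≥ 8`.

Mathlib: `Complex.closure_setOf_lt_im`, `interior_mono`, `IsOpen.interior_eq`.

## References

* H. Duminil-Copin, G. Kozma, A. Yadin, Ann. IHP Probab. Stat. 50 (2014) 315–326,
  arXiv:1110.3074: Theorem 1 (p. 2), Conjecture 11 (p. 8). [DuminilCopinKozmaYadin2014]
* S. Rohde, O. Schramm, *Basic properties of SLE*, Ann. of Math. 161 (2005), arXiv:math/0106036:
  §1 (p. 2: "for `κ ∈ (4,8)` it is a self-intersecting path"), Lemma 6.3 and Thm 6.4 (every point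
  is swallowed, the trace misses it), §6 Thm 6.1 (`κ ≤ 4`). [RohdeSchramm2005]
-/

noncomputable section

open MeasureTheory Filter Topology Metric Set Literature.Probability.LatticeModels
  Literature.Probability.Percolation Literature.Probability.RandomPlanarGeometry
  Literature.Probability.RandomPlanarGeometry.SAW
open UpperHalfPlane (upperHalfPlaneSet isOpen_upperHalfPlaneSet)
open scoped ENNReal NNReal

namespace Literature.Barriers.CriticalPhenomena

namespace SupercriticalSAW

/-! ### The self-touching phase `4 < κ < 8` -/

section SelfTouching

variable {κ : ℝ≥0} {D : DobrushinDomain} {Γ : (ℝ≥0 → ℝ) → CurveClass ℂ}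

/-- **Chordal SLE_κ in `(D; a, b)`, `4 < κ < 8`, is almost surely NOT onto `D`**: the range of
the half-plane trace has empty interior (`ae_isSelfTouching_sleTrace_holds`), whereas a
compactified image `Φ ∘ γ` onto `D` would force `ℍ ⊆ γ[0,∞)` — real parameters of `γ` go to
`∂D` under the boundary extension (`JordanDomain.exists_hasBoundaryValue_holds`), the terminal
parameter goes to `b ∈ ∂D`, and `φ` is injective on `ℍ`. No named fact is used.
[cite: RohdeSchramm2005, §1 p. 885 and Thm 6.4] -/
theorem ae_not_carrier_subset_range_of_isSLECurve_of_lt_eight (h4 : 4 < κ) (h8 : κ < 8)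
    (hΓ : IsSLECurve κ D Γ) :
    ∀ᵐ ω ∂Literature.Probability.Process.preWienerMeasure, ¬ D.carrier ⊆ (Γ ω).range := by
  obtain ⟨-, φ, hφ, hae⟩ := hΓ
  have hD : IsOpen D.carrier := D.isOpen
  have hnot1 : D.pt 1 ∉ D.carrier := fun h =>
    (D.pt_mem_frontier 1).2 (by rwa [hD.interior_eq])
  filter_upwards [hae, ae_isSelfTouching_sleTrace_holds (κ := κ) ⟨h4, h8⟩] with ω ⟨hgen, c, hΓω, hc⟩ hst
  intro hsub
  -- `ℍ ⊆ γ[0, ∞)`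
  have hH : upperHalfPlaneSet ⊆ Set.range (sleTrace κ ω) := by
    intro z hz
    have hmem : φ z ∈ (Γ ω).range := hsub (φ.mapsTo hz)
    rw [hΓω, CurveClass.range_mk] at hmem
    obtain ⟨s, hs⟩ := hmem
    by_cases hs1 : (s : ℝ) < 1
    · rw [hc.1 s hs1] at hs
      by_cases ht : sleTrace κ ω (rayParam s) ∈ upperHalfPlaneSet
      · rw [φ.boundaryExtension_eq ht] at hs
        exact ⟨rayParam s, φ.injOn ht hz hs⟩
      · exfalso
        -- `γ t` is real, so `Φ (γ t) ∈ ∂D`, but `Φ (γ t) = φ z ∈ D`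
        have him0 : 0 ≤ (sleTrace κ ω (rayParam s)).im := hgen.2.2.1 _
        have him : (sleTrace κ ω (rayParam s)).im = 0 := by
          refine le_antisymm (not_lt.1 fun hlt => ht ?_) him0
          exact hlt
        obtain ⟨p, hp, hpv⟩ := JordanDomain.exists_hasBoundaryValue_holds D.toJordanDomain φ
          (sleTrace κ ω (rayParam s)).re
        have hx : (((sleTrace κ ω (rayParam s)).re : ℝ) : ℂ) = sleTrace κ ω (rayParam s) :=
          Complex.ext (by simp) (by simp [him])
        have hcl : (((sleTrace κ ω (rayParam s)).re : ℝ) : ℂ) ∈ closure upperHalfPlaneSet := by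
          rw [show closure upperHalfPlaneSet = {z : ℂ | 0 ≤ z.im} from Complex.closure_setOf_lt_im 0]
          simp
        have hΦ := φ.boundaryExtension_eq_of_hasBoundaryValue hcl hpv
        rw [hx] at hΦ
        rw [hΦ] at hs
        -- `p = φ z ∈ D` and `p ∈ ∂D`
        exact hp.2 (by rw [hD.interior_eq, hs]; exact φ.mapsTo hz)
    · exfalso
      rw [unitInterval.eq_one_of_not_lt hs1, hc.2] at hs
      exact hnot1 (hs ▸ φ.mapsTo hz)
  -- … contradicting the empty interior of the trace
  have hI : Complex.I ∈ interior (Set.range (sleTrace κ ω)) :=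
    interior_mono hH (by
      rw [isOpen_upperHalfPlaneSet.interior_eq]
      show 0 < Complex.I.im
      simp)
  have hempty := hst.2
  rw [Set.eq_empty_iff_forall_notMem] at hempty
  exact hempty _ hI

/-- Hence chordal SLE_κ, `4 < κ < 8`, is not almost surely onto `D`. [cite: RohdeSchramm2005, §1 p. 885 and Thm 6.4] -/
theorem not_ae_carrier_subset_range_of_isSLECurve_of_lt_eight (h4 : 4 < κ) (h8 : κ < 8)
    (hΓ : IsSLECurve κ D Γ) :
    ¬ ∀ᵐ ω ∂Literature.Probability.Process.preWienerMeasure, D.carrier ⊆ (Γ ω).range := by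
  haveI := Literature.Probability.Process.isProbabilityMeasure_preWienerMeasure
    isProjectiveLimit_preWienerMeasure_holds
  intro hon
  obtain ⟨ω, hω₁, hω₂⟩ :=
    ((ae_not_carrier_subset_range_of_isSLECurve_of_lt_eight h4 h8 hΓ).and hon).exists
  exact hω₁ hω₂

/-- **For every `0 < κ < 8`, chordal SLE_κ in `(D; a, b)` is not almost surely onto `D`**
(`κ ≤ 4`: `not_ae_carrier_subset_range_of_isSLECurve` of `…Unconditional`; `4 < κ < 8`: the
previous theorem). Hypothesis-free. [cite: RohdeSchramm2005, Thm 6.1] -/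
theorem not_ae_carrier_subset_range_of_isSLECurve_of_lt_eight' (h0 : 0 < κ) (h8 : κ < 8)
    (hΓ : IsSLECurve κ D Γ) :
    ¬ ∀ᵐ ω ∂Literature.Probability.Process.preWienerMeasure, D.carrier ⊆ (Γ ω).range := by
  rcases le_or_gt κ 4 with h4 | h4
  · exact not_ae_carrier_subset_range_of_isSLECurve h0 h4 hΓ
  · exact not_ae_carrier_subset_range_of_isSLECurve_of_lt_eight h4 h8 hΓ

end SelfTouching

/-! ### Supercritical SAWs converge to no chordal SLE_κ, `κ < 8` -/

section BelowEight

variable {κ : ℝ≥0} {D : DobrushinDomain} {A B : ℝ → Site 2}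
  {P : ∀ δ : ℝ, Measure (DomainSAW D.carrier δ (A δ) (B δ))}

/-- **Weakly space-filling SAW laws converge to no chordal SLE_κ with `0 < κ < 8`**
(hypothesis-free). [cite: DuminilCopinKozmaYadin2014, §1 and Conjecture 11] -/
theorem IsSpaceFillingLaws.not_convergesInLawToSLE_of_lt_eight [∀ δ, IsFiniteMeasure (P δ)]
    (hfill : IsSpaceFillingLaws D.carrier A B P) (h0 : 0 < κ) (h8 : κ < 8) :
    ¬ ConvergesInLawToSLE κ D (fun δ (γ : DomainSAW D.carrier δ (A δ) (B δ)) => γ.curve) P :=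
  hfill.not_convergesInLawToSLE_of_not_ae_onto fun _ hΓ =>
    not_ae_carrier_subset_range_of_isSLECurve_of_lt_eight' h0 h8 hΓ

/-- **For every `x > x_c` and every `0 < κ < 8`, the SAW with parameter `x` in `(𝔻; 1, -1)` with
closest-site endpoints does not converge in law to chordal SLE_κ** — Theorem 1 of the source
(`DKY2014_thm1_holds`) with the Rohde–Schramm phase theorems, all proved in the tree; the only
chordal SLEs not excluded are the space-filling ones, `κ ≥ 8`, as Conjecture 11 of the source
predicts (SLE₈). [cite: DuminilCopinKozmaYadin2014, Theorem 1 and Conjecture 11] -/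
theorem not_convergesInLawToSLE_supercritical_unitDisc_of_lt_eight {x : ℝ}
    (hx : criticalFugacity < x) (h0 : 0 < κ) (h8 : κ < 8)
    (hAB : ∀ δ : ℝ, 0 < δ → IsClosestSite unitDisk δ 1 (A δ) ∧ IsClosestSite unitDisk δ (-1) (B δ)) :
    ¬ ConvergesInLawToSLE κ DobrushinDomain.unitDisc
        (fun δ (γ : DomainSAW DobrushinDomain.unitDisc.carrier δ (A δ) (B δ)) => γ.curve)
        (fun δ => lawAt x DobrushinDomain.unitDisc.carrier δ (A δ) (B δ)) := by
  have hne : (1 : ℂ) ≠ -1 := fun h => by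
    have h' := congrArg Complex.re h
    norm_num at h'
  have hfill : IsSpaceFillingLaws DobrushinDomain.unitDisc.carrier A B
      (fun δ => lawAt x DobrushinDomain.unitDisc.carrier δ (A δ) (B δ)) :=
    isSpaceFillingLaws_lawAt_iff.2
      (isSpaceFillingFamily_of_DKY2014_thm1 DKY2014_thm1_holds (by simp) (by simp) hne hAB hx)
  exact hfill.not_convergesInLawToSLE_of_lt_eight h0 h8

end BelowEight

end SupercriticalSAW

end Literature.Barriers.CriticalPhenomena
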